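import Summits.NavierStokesRegularity.OSWSelfSimilar.SheetREnergySpace
import HarnessLib

/-!
# SHEET-ℝ frame, MODEL ASSEMBLY layer 3b: the test space as a vector space, its embedding `j` into the energy Hilbert space, and
# the weighted bounds of a compactly supported test

HONEST FRAMING (cell ns-blowup GROUP B / zone Z3, cases Z3-SR-CERT / Z3-SR-SPEC; 1-D MODEL certificate frame (viscous gCLM/OSW sheet on the
line); not Euler/NS; «violates: none — MODEL»). Nothing here asserts that a profile exists.

Lions' theorem in operator form (`Literature.Analysis.OperatorTheory.exists_solutionOperator_of_coercive`) wants: a Hilbert space `F`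
(here `SheetREnergySpace.Esp L hL`), a VECTOR SPACE `Φ` of tests with a linear `j : Φ → F`, and bounds.  This file supplies `Φ` and `j`:

* `IsCompactTest` pairs are closed under `0`, `+`, `•` (`isCompactTest_zero/_add/_smul`), so **`testSpace`** — the compactly supported odd
  energy-class tests of `SheetRLinearisedTests` — is a `Submodule ℝ ((ℝ → ℝ) × (ℝ → ℝ))`;
* a test `(v, v₁)` is continuous and bounded, `v(0) = 0`, `v = prim v₁`, and carries the weights: `∫ w v² < ∞`, `∫ w v₁² < ∞`
  (`weighted_of_isCompactTest`), so `v, v₁ ∈ W L = L²_w`;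
* **`jmap`**: `testSpace →ₗ[ℝ] Esp L hL`, `(v, v₁) ↦ (½·v, v₁)` (as `L²_w` classes), with `‖jmap (v,v₁)‖² = ¼∫wv² + ∫wv₁²` (`sq_norm_jmap`) and
  the function-language read-back `prim (jmap vp).snd = v`, `(jmap vp).snd =ᵐ v₁` (`prim_jmap_snd`, `jmap_snd_ae`).
One definition (`testSpace`) and one bundled map (`jmap`); no named fact. WHAT THIS IS NOT: not NS; no number moves; the solution operator is
`SheetRSolutionOperator.lean`.
-/

noncomputable section

namespace Summit.NavierStokesRegularity.OSWSelfSimilar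
namespace SheetRTestSpace

open _root_.MeasureTheory _root_.Set _root_.Filter _root_.Real SheetRWeakProfilePV SheetRWeakToStrong SheetREnergyClass SheetRWeightedMeasure
  SheetRLinearisedTests SheetREnergySpace
open scoped Topology ENNReal

/-! ### §1 Closure properties of the test class -/

/-- The zero pair is a test. [folklore] -/
theorem isCompactTest_zero : IsCompactTest (0 : ℝ → ℝ) (0 : ℝ → ℝ) :=
  ⟨fun x => by simp, fun y => by simp, MemLp.zero, ⟨0, fun x _ => by simp⟩⟩

/-- Tests are closed under addition. [folklore] -/
theorem isCompactTest_add {v v₁ v' v₁' : ℝ → ℝ} (h : IsCompactTest v v₁) (h' : IsCompactTest v' v₁') :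
    IsCompactTest (v + v') (v₁ + v₁') := by
  refine ⟨fun x => ?_, fun y => ?_, h.memLp.add h'.memLp, ?_⟩
  · simp only [Pi.add_apply]
    rw [intervalIntegral.integral_add (intervalIntegrable_of_memLp_two h.memLp 0 x) (intervalIntegrable_of_memLp_two h'.memLp 0 x),
      h.primitive x, h'.primitive x]
    have := h.primitive 0
    have := h'.primitive 0
    simp only [intervalIntegral.integral_same, add_zero] at *
    ring
  · simp only [Pi.add_apply, h.odd, h'.odd]; ring
  · obtain ⟨R, hR⟩ := h.support
    obtain ⟨R', hR'⟩ := h'.support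
    refine ⟨max R R', fun x hx => ?_⟩
    obtain ⟨h1, h2⟩ := hR x ((le_max_left _ _).trans hx)
    obtain ⟨h1', h2'⟩ := hR' x ((le_max_right _ _).trans hx)
    simp [h1, h2, h1', h2']

/-- Tests are closed under scalar multiplication. [folklore] -/
theorem isCompactTest_smul {v v₁ : ℝ → ℝ} (c : ℝ) (h : IsCompactTest v v₁) : IsCompactTest (c • v) (c • v₁) := by
  refine ⟨fun x => ?_, fun y => ?_, h.memLp.const_smul c, ?_⟩
  · simp only [Pi.smul_apply, smul_eq_mul]
    rw [intervalIntegral.integral_const_mul, h.primitive x]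
    have := h.primitive 0
    simp only [intervalIntegral.integral_same, add_zero] at this
    ring
  · simp only [Pi.smul_apply, smul_eq_mul, h.odd]; ring
  · obtain ⟨R, hR⟩ := h.support
    refine ⟨R, fun x hx => ?_⟩
    obtain ⟨h1, h2⟩ := hR x hx
    simp [h1, h2]

/-- **The test space** (compactly supported odd energy-class tests) as a submodule of `(ℝ → ℝ) × (ℝ → ℝ)`. [folklore] -/
def testSpace : Submodule ℝ ((ℝ → ℝ) × (ℝ → ℝ)) where
  carrier := {vp | IsCompactTest vp.1 vp.2}
  add_mem' := fun {_ _} ha hb => isCompactTest_add ha hb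
  zero_mem' := isCompactTest_zero
  smul_mem' := fun c {_} ha => isCompactTest_smul c ha

/-- Membership in `testSpace`. [folklore] -/
theorem mem_testSpace_iff (vp : (ℝ → ℝ) × (ℝ → ℝ)) : vp ∈ testSpace ↔ IsCompactTest vp.1 vp.2 := Iff.rfl

/-! ### §2 A test is continuous, bounded, starts at `0`, is the primitive of its derivative, and carries the weights -/

/-- Basic facts of a test `(v, v₁)`: `v` continuous, `v(0) = 0`, `v = prim v₁`, and `|v| ≤ B` for some `B`. [folklore] -/
theorem basic_of_isCompactTest {v v₁ : ℝ → ℝ} (h : IsCompactTest v v₁) :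
    Continuous v ∧ v 0 = 0 ∧ (∀ x, prim v₁ x = v x) ∧ ∃ B : ℝ, 0 ≤ B ∧ ∀ x, |v x| ≤ B := by
  have hii : ∀ a b, IntervalIntegrable v₁ volume a b := intervalIntegrable_of_memLp_two h.memLp
  have hc : Continuous v := continuous_of_primitive h.primitive hii
  have h0 : v 0 = 0 := by
    have := h.odd 0
    rw [neg_zero] at this
    linarith
  have hprim : ∀ x, prim v₁ x = v x := fun x => by rw [prim_apply, h.primitive x, h0, zero_add]
  obtain ⟨R, hR⟩ := h.support
  -- bounded: continuous on the compact `[-|R|-1, |R|+1]`, zero outside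
  obtain ⟨B, hB⟩ := isCompact_Icc.exists_bound_of_continuousOn (hc.continuousOn (s := Icc (-(|R| + 1)) (|R| + 1)))
  refine ⟨hc, h0, hprim, ⟨max B 0, le_max_right _ _, fun x => ?_⟩⟩
  by_cases hx : x ∈ Icc (-(|R| + 1)) (|R| + 1)
  · exact ((Real.norm_eq_abs _).symm.le.trans (hB x hx)).trans (le_max_left _ _)
  · have hx' : R ≤ |x| := by
      have h1 : |R| + 1 < |x| := by
        by_contra hle
        exact hx (mem_Icc.2 (abs_le.1 (not_lt.1 hle)))
      linarith [le_abs_self R]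
    rw [(hR x hx').1, abs_zero]
    exact le_max_right _ _

/-- **Weights of a test**: `∫ (L²+ξ²)v² < ∞` and `∫ (L²+ξ²)v₁² < ∞` (both vanish off `|ξ| < R`, where the weight is bounded). [folklore] -/
theorem weighted_of_isCompactTest {L : ℝ} {v v₁ : ℝ → ℝ} (h : IsCompactTest v v₁) :
    Integrable (fun y => (L ^ 2 + y ^ 2) * v y ^ 2) ∧ Integrable (fun y => (L ^ 2 + y ^ 2) * v₁ y ^ 2) := by
  obtain ⟨hc, -, -, B, hB0, hB⟩ := basic_of_isCompactTest h
  obtain ⟨R, hR⟩ := h.support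
  have hw : ∀ y : ℝ, |y| < R → L ^ 2 + y ^ 2 ≤ L ^ 2 + R ^ 2 := fun y hy => by
    have : y ^ 2 ≤ R ^ 2 := by rw [← sq_abs y]; exact pow_le_pow_left₀ (abs_nonneg _) hy.le 2
    linarith
  have hwm : AEStronglyMeasurable (fun y : ℝ => L ^ 2 + y ^ 2) volume := by fun_prop
  constructor
  · -- `w v² ≤ (L²+R²) v²` and `v²` is integrable (`v ∈ L²`: `|v| ≤ B`, vanishing off `|ξ| < R` … simpler: `v² ≤ B|v|`? use `v ∈ L²` from primitive form)
    have hv2 : MemLp v 2 volume := by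
      -- `v` continuous, bounded by `B`, supported in `closedBall 0 R`
      have hsupp : HasCompactSupport v := by
        refine HasCompactSupport.intro (isCompact_Icc : IsCompact (Icc (-|R|) |R|)) fun x hx => ?_
        have : R ≤ |x| := by
          simp only [mem_Icc, not_and_or, not_le] at hx
          rcases hx with hx | hx
          · linarith [le_abs_self R, neg_abs_le x, abs_nonneg R, show |x| ≥ -x from neg_le_abs x]
          · linarith [le_abs_self R, le_abs_self x]
        exact (hR x this).1
      exact (hc.memLp_of_hasCompactSupport (μ := volume) hsupp)
    refine ((hv2.integrable_sq).const_mul (L ^ 2 + R ^ 2)).mono' (hwm.mul (hc.aestronglyMeasurable.pow 2))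
      (Eventually.of_forall fun y => ?_)
    rw [Real.norm_eq_abs, abs_of_nonneg (by positivity)]
    by_cases hy : |y| < R
    · exact mul_le_mul_of_nonneg_right (hw y hy) (sq_nonneg _)
    · rw [(hR y (not_lt.1 hy)).1]; simp
  · refine ((h.memLp.integrable_sq).const_mul (L ^ 2 + R ^ 2)).mono' (hwm.mul (h.memLp.1.pow 2))
      (Eventually.of_forall fun y => ?_)
    rw [Real.norm_eq_abs, abs_of_nonneg (by positivity)]
    by_cases hy : |y| < R
    · exact mul_le_mul_of_nonneg_right (hw y hy) (sq_nonneg _)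
    · rw [(hR y (not_lt.1 hy)).2]; simp

/-- A test pair gives two elements of `W L`. [folklore] -/
theorem memLp_W_of_isCompactTest {L : ℝ} {v v₁ : ℝ → ℝ} (h : IsCompactTest v v₁) : MemLp v 2 (μw L) ∧ MemLp v₁ 2 (μw L) := by
  obtain ⟨hc, -, -, -⟩ := basic_of_isCompactTest h
  obtain ⟨hv, hv₁⟩ := weighted_of_isCompactTest (L := L) h
  exact ⟨memLp_W hc.aestronglyMeasurable hv, memLp_W h.memLp.1 hv₁⟩

/-! ### §3 The embedding `jmap : testSpace →ₗ Esp L hL`, `(v, v₁) ↦ (½v, v₁)` -/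

/-- The underlying pair of `L²_w` classes of a test. [folklore] -/
theorem jmap_mem {L : ℝ} (hL : 0 < L) (vp : testSpace) :
    WithLp.toLp 2 (((1 / 2 : ℝ) • (memLp_W_of_isCompactTest (L := L) vp.2).1.toLp vp.1.1),
      (memLp_W_of_isCompactTest (L := L) vp.2).2.toLp vp.1.2) ∈ Esp L hL := by
  obtain ⟨hc, h0, hprim, -⟩ := basic_of_isCompactTest vp.2
  set a : W L := (memLp_W_of_isCompactTest (L := L) vp.2).1.toLp vp.1.1 with ha
  set b : W L := (memLp_W_of_isCompactTest (L := L) vp.2).2.toLp vp.1.2 with hb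
  have hae_a : (a : ℝ → ℝ) =ᵐ[volume] vp.1.1 := ae_volume_of_ae_μw hL (MemLp.coeFn_toLp _)
  have hae_b : (b : ℝ → ℝ) =ᵐ[volume] vp.1.2 := ae_volume_of_ae_μw hL (MemLp.coeFn_toLp _)
  have hprimb : prim (b : ℝ → ℝ) = vp.1.1 := by
    rw [prim_congr_ae hae_b]; funext x; exact hprim x
  have hfst : ((WithLp.toLp 2 (((1 / 2 : ℝ) • a), b)).fst : ℝ → ℝ) =ᵐ[volume] fun y => (1 / 2) * vp.1.1 y := by
    have h1 : (((1 / 2 : ℝ) • a : W L) : ℝ → ℝ) =ᵐ[volume] fun y => (1 / 2) * (a : ℝ → ℝ) y :=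
      (ae_volume_of_ae_μw hL (Lp.coeFn_smul (1 / 2 : ℝ) a)).mono fun y hy => by rw [hy, Pi.smul_apply, smul_eq_mul]
    exact h1.trans (hae_a.mono fun y hy => by simp only [hy])
  rw [mem_Esp_iff]
  refine ⟨fun x => ?_, fun x => ?_⟩
  · have hsnd : (WithLp.toLp 2 (((1 / 2 : ℝ) • a), b)).snd = b := rfl
    rw [hsnd, hprimb]
    have hcongr : ∫ s in (0 : ℝ)..x, (2 * ((WithLp.toLp 2 (((1 / 2 : ℝ) • a), b)).fst : ℝ → ℝ) s - vp.1.1 s) =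
        ∫ s in (0 : ℝ)..x, (0 : ℝ) :=
      intervalIntegral.integral_congr_ae (hfst.mono fun y hy _ => by rw [hy]; ring)
    rw [hcongr, intervalIntegral.integral_zero]
  · have hsnd : (WithLp.toLp 2 (((1 / 2 : ℝ) • a), b)).snd = b := rfl
    rw [hsnd, hprimb]
    exact vp.2.odd x

/-- **The embedding of the tests into the energy space**, `(v, v₁) ↦ (½v, v₁)`. [folklore] -/
def jmap {L : ℝ} (hL : 0 < L) : testSpace →ₗ[ℝ] Esp L hL where
  toFun vp := ⟨WithLp.toLp 2 (((1 / 2 : ℝ) • (memLp_W_of_isCompactTest (L := L) vp.2).1.toLp vp.1.1),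
      (memLp_W_of_isCompactTest (L := L) vp.2).2.toLp vp.1.2), jmap_mem hL vp⟩
  map_add' vp vq := by
    apply Subtype.ext
    simp only [Submodule.coe_add]
    have h1 : ((memLp_W_of_isCompactTest (L := L) (vp + vq).2).1.toLp ((vp : (ℝ → ℝ) × (ℝ → ℝ)) + vq).1 : W L) =
        (memLp_W_of_isCompactTest (L := L) vp.2).1.toLp vp.1.1 + (memLp_W_of_isCompactTest (L := L) vq.2).1.toLp vq.1.1 := by
      rw [← MemLp.toLp_add]; rfl
    have h2 : ((memLp_W_of_isCompactTest (L := L) (vp + vq).2).2.toLp ((vp : (ℝ → ℝ) × (ℝ → ℝ)) + vq).2 : W L) =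
        (memLp_W_of_isCompactTest (L := L) vp.2).2.toLp vp.1.2 + (memLp_W_of_isCompactTest (L := L) vq.2).2.toLp vq.1.2 := by
      rw [← MemLp.toLp_add]; rfl
    rw [h1, h2, ← WithLp.toLp_add, Prod.mk_add_mk, smul_add]
  map_smul' c vp := by
    apply Subtype.ext
    simp only [Submodule.coe_smul, RingHom.id_apply]
    have h1 : ((memLp_W_of_isCompactTest (L := L) (c • vp).2).1.toLp (c • (vp : (ℝ → ℝ) × (ℝ → ℝ))).1 : W L) =
        c • (memLp_W_of_isCompactTest (L := L) vp.2).1.toLp vp.1.1 := by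
      rw [← MemLp.toLp_const_smul]; rfl
    have h2 : ((memLp_W_of_isCompactTest (L := L) (c • vp).2).2.toLp (c • (vp : (ℝ → ℝ) × (ℝ → ℝ))).2 : W L) =
        c • (memLp_W_of_isCompactTest (L := L) vp.2).2.toLp vp.1.2 := by
      rw [← MemLp.toLp_const_smul]; rfl
    rw [h1, h2, ← WithLp.toLp_smul, Prod.smul_mk, smul_comm c (1 / 2 : ℝ)]

/-- Components of `jmap`: the second component is the `L²_w` class of `v₁` … [folklore] -/
theorem jmap_snd {L : ℝ} (hL : 0 < L) (vp : testSpace) :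
    ((jmap hL vp : Esp L hL) : WithLp 2 (W L × W L)).snd = (memLp_W_of_isCompactTest (L := L) vp.2).2.toLp vp.1.2 := rfl

/-- … and the first is `½` times the class of `v`. [folklore] -/
theorem jmap_fst {L : ℝ} (hL : 0 < L) (vp : testSpace) :
    ((jmap hL vp : Esp L hL) : WithLp 2 (W L × W L)).fst = (1 / 2 : ℝ) • (memLp_W_of_isCompactTest (L := L) vp.2).1.toLp vp.1.1 := rfl

/-- Read-back: `(jmap vp).snd = v₁` a.e. and `prim (jmap vp).snd = v` everywhere. [folklore] -/
theorem jmap_snd_ae {L : ℝ} (hL : 0 < L) (vp : testSpace) :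
    ((((jmap hL vp : Esp L hL) : WithLp 2 (W L × W L)).snd : W L) : ℝ → ℝ) =ᵐ[volume] vp.1.2 ∧
      prim ((((jmap hL vp : Esp L hL) : WithLp 2 (W L × W L)).snd : W L) : ℝ → ℝ) = vp.1.1 := by
  obtain ⟨-, -, hprim, -⟩ := basic_of_isCompactTest vp.2
  have hae : ((((jmap hL vp : Esp L hL) : WithLp 2 (W L × W L)).snd : W L) : ℝ → ℝ) =ᵐ[volume] vp.1.2 := by
    rw [jmap_snd]; exact ae_volume_of_ae_μw hL (MemLp.coeFn_toLp _)
  refine ⟨hae, ?_⟩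
  rw [prim_congr_ae hae]; funext x; exact hprim x

/-- **The energy norm of a test**: `‖jmap (v, v₁)‖² = ¼∫(L²+ξ²)v² + ∫(L²+ξ²)v₁²`. [folklore] -/
theorem sq_norm_jmap {L : ℝ} (hL : 0 < L) (vp : testSpace) :
    ‖jmap hL vp‖ ^ 2 = 1 / 4 * (∫ y, (L ^ 2 + y ^ 2) * vp.1.1 y ^ 2) + ∫ y, (L ^ 2 + y ^ 2) * vp.1.2 y ^ 2 := by
  have hn : ‖jmap hL vp‖ = ‖((jmap hL vp : Esp L hL) : WithLp 2 (W L × W L))‖ := rfl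
  rw [hn, WithLp.prod_norm_sq_eq_of_L2, jmap_fst, jmap_snd, norm_smul, mul_pow, sq_norm_W, sq_norm_W]
  have hae_a : (((memLp_W_of_isCompactTest (L := L) vp.2).1.toLp vp.1.1 : W L) : ℝ → ℝ) =ᵐ[volume] vp.1.1 :=
    ae_volume_of_ae_μw hL (MemLp.coeFn_toLp _)
  have hae_b : (((memLp_W_of_isCompactTest (L := L) vp.2).2.toLp vp.1.2 : W L) : ℝ → ℝ) =ᵐ[volume] vp.1.2 :=
    ae_volume_of_ae_μw hL (MemLp.coeFn_toLp _)
  have e1 : ∫ y, (L ^ 2 + y ^ 2) * (((memLp_W_of_isCompactTest (L := L) vp.2).1.toLp vp.1.1 : W L) : ℝ → ℝ) y ^ 2 =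
      ∫ y, (L ^ 2 + y ^ 2) * vp.1.1 y ^ 2 := integral_congr_ae (hae_a.mono fun y hy => by simp only [hy])
  have e2 : ∫ y, (L ^ 2 + y ^ 2) * (((memLp_W_of_isCompactTest (L := L) vp.2).2.toLp vp.1.2 : W L) : ℝ → ℝ) y ^ 2 =
      ∫ y, (L ^ 2 + y ^ 2) * vp.1.2 y ^ 2 := integral_congr_ae (hae_b.mono fun y hy => by simp only [hy])
  rw [e1, e2]
  norm_num

end SheetRTestSpace
end Summit.NavierStokesRegularity.OSWSelfSimilar

end
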